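import Mathlib
import Summits.KontsevichZagierPeriods.Zeta5Search.DenomLaw.FlagRayCStar
import HarnessLib

/-!
# ζ(5) search — `C⋆` on the θ-cells of the band-60 FLAG ray, part 2 (`p > 20n, 21n, 22n`)

Cell `pub-zeta5` (HONEST FRAMING: systematic search; no irrationality claim unless certified), TRACK «DENOM-LAW» D1 prover seat
(denom-prover-d1 g12, `HOME/denom-law/prover-d1/ATTEMPT-12.md`).  The PATH ACCOUNTING node's combinatorial datum `C⋆_p(b) = cStar b p` on the
band-60 FLAG ray `b(n) = n·(60; 25,24,22,21,19,18,16)`: by the tree's profile tool `cStar_le_of_profile` (`DenomLaw/PathWeightProfile`), a lower bound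
`p > ℓ·n` fixes which parameters (`β_i > ℓ`) and which pair blocks (`60 − β_i − β_k > ℓ`) may reach `p`, and one `decide` over the 5,040 orderings
bounds `C⋆`: `C⋆ ≤ 10` for `p > 17n`, `≤ 9` for `p > 18n`, `≤ 8` for `p > 19n`, `≤ 7` for `p > 20n`, `≤ 6` for `p > 21n`, `≤ 5` for `p > 22n`
(all attained on the next cell: brute force, `n ≤ 12`).  Pure combinatorics; nothing about ζ(5) or irrationality.
-/

open Finset

namespace Summit.KontsevichZagierPeriods.Zeta5Search.StairFLAG

open Summit.KontsevichZagierPeriods.Zeta5Search.DenomLaw (cStar)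
open Summit.KontsevichZagierPeriods.Zeta5Search.DenomLaw.FirstPeriodKit (cStar_le_of_profile)
open Summit.KontsevichZagierPeriods.Zeta5Search.StaircaseCells (bRay)

/-- **`C⋆ ≤ 7` for `p > 20n`.** -/
theorem cStar_flag_le_seven {n p : ℕ} (hp : 20 * n < p) : cStar (bRay [60, 25, 24, 22, 21, 19, 18, 16] n) p ≤ 7 := by
  obtain ⟨h1, h2⟩ := flag_profile hp
  exact cStar_le_of_profile (fun i : Fin 7 => 20 + 1 ≤ (25 - i.val - i.val / 2))
    (fun i k : Fin 7 => (25 - i.val - i.val / 2) + (25 - k.val - k.val / 2) + 20 + 1 ≤ 60)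
    7 h1 h2 (by decide +kernel)

/-- **`C⋆ ≤ 6` for `p > 21n`.** -/
theorem cStar_flag_le_six {n p : ℕ} (hp : 21 * n < p) : cStar (bRay [60, 25, 24, 22, 21, 19, 18, 16] n) p ≤ 6 := by
  obtain ⟨h1, h2⟩ := flag_profile hp
  exact cStar_le_of_profile (fun i : Fin 7 => 21 + 1 ≤ (25 - i.val - i.val / 2))
    (fun i k : Fin 7 => (25 - i.val - i.val / 2) + (25 - k.val - k.val / 2) + 21 + 1 ≤ 60)
    6 h1 h2 (by decide +kernel)

/-- **`C⋆ ≤ 5` for `p > 22n`.** -/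
theorem cStar_flag_le_five {n p : ℕ} (hp : 22 * n < p) : cStar (bRay [60, 25, 24, 22, 21, 19, 18, 16] n) p ≤ 5 := by
  obtain ⟨h1, h2⟩ := flag_profile hp
  exact cStar_le_of_profile (fun i : Fin 7 => 22 + 1 ≤ (25 - i.val - i.val / 2))
    (fun i k : Fin 7 => (25 - i.val - i.val / 2) + (25 - k.val - k.val / 2) + 22 + 1 ≤ 60)
    5 h1 h2 (by decide +kernel)

end Summit.KontsevichZagierPeriods.Zeta5Search.StairFLAG
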